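import Summits.ValiantsHypothesis.ValiantsHypothesis.Theorems.NewtonFramesTwoProductsFrameRungTwoTrinomialRigidity

/-!
# Crux `TwoProducts` (stmt-5906), line `FrameRungTwo`: the vertex form for trinomial frames, and the counting sets

Third of four files.  `vertex_form_three`: under the hypotheses of `matched_three`, the word of an uncancelled exponent `e`
demotes AT MOST ONE letter of its top tuple, OR `e` is the common top sum minus BOTH gaps of ONE coordinate of the other frame
(`T − g¹_p − g²_p`, the genuinely trinomial vertex shape — two matched gaps landing in one coordinate, with no third demoted
letter by `no_double_match`).  `card_cover2_le`: the trinomial-shape points over all key-top tuples (the floor's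
`stub_topTupleCount`), coordinates and letter pairs number `≤ (4 (m t)² + 7) · m t²`; `count_arith_three`: the final
arithmetic `… ≤ (m t + 2)^6` for `t ≤ 3`.
Honest scope: a `t`-variant (trinomial frames without parallelogram coincidences, `k ≤ 2`) of ONE stub of a rung strictly
below the crux `TwoProducts`; nothing here bears on the crux in general or on `VP ≠ VNP`. [ours; setting KPTT arXiv:1308.2286 §2, §5]
-/

set_option linter.dupNamespace false

namespace Summit.ValiantsHypothesis.ValiantsHypothesis.Theorems.NewtonFramesTwoProducts.FrameRungTwoTrinomial

open MvPolynomial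
open scoped BigOperators Classical
open Summit.ValiantsHypothesis.Theorems.DissociatedFixedK (lexKey lexKey_injective lexTop lexTop_mem lexKey_le_lexTop
  stub_topTupleCount count_arith)
open Summit.ValiantsHypothesis.ValiantsHypothesis.Theorems.DissociatedFixedK.Negative (emb emb_injective)
open Summit.ValiantsHypothesis.ValiantsHypothesis.Theorems.NewtonFramesTwoProducts.FrameRungTwoBinomial
  (emb_add emb_sum lexKey_sum apply_le_of_lexKey_le lexKey_lt_of_apply_lt lexKey_sum_lt_sum lexKey_sum_le_sum
   eq_T_of_not_mem_filter ne_T_of_mem_filter lexKey_sum_lt_T lexKey_sum_le_T coeff_word exists_word prod_coeff_ne_zero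
   top_eq mem_cover card_cover_le cross_empty_of_union_subset support_filter_sum_subset_one)

noncomputable section

section Vertex

variable {m : ℕ}

/-- **Vertex form.**  A word of `f` whose sum `e` is not cancelled demotes at most ONE letter of the top tuple, OR `e` is the
common top sum minus BOTH gaps of ONE coordinate of `g` (two distinct non-top letters `y₁, y₂` of some `supp (g p)`). -/
theorem vertex_form_three (l : (Fin 2 → ℝ) →L[ℝ] ℝ) (f g : Fin m → MvPolynomial (Fin 2) ℂ) (T T' : Fin m → (Fin 2 →₀ ℕ))
    (hT : ∀ j, T j ∈ (f j).support) (hTmax : ∀ j, ∀ x ∈ (f j).support, lexKey l x ≤ lexKey l (T j))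
    (hT' : ∀ j, T' j ∈ (g j).support) (hTmax' : ∀ j, ∀ x ∈ (g j).support, lexKey l x ≤ lexKey l (T' j))
    (hinjf : ∀ a b : Fin m → (Fin 2 →₀ ℕ), (∀ j, a j ∈ (f j).support) → (∀ j, b j ∈ (f j).support) →
      ∑ j, a j = ∑ j, b j → a = b)
    (hinjg : ∀ a b : Fin m → (Fin 2 →₀ ℕ), (∀ j, a j ∈ (g j).support) → (∀ j, b j ∈ (g j).support) →
      ∑ j, a j = ∑ j, b j → a = b)
    (hparf : ∀ (a : Fin m → (Fin 2 →₀ ℕ)) (p : Fin m) (x y : Fin 2 →₀ ℕ), (∀ j, a j ∈ (f j).support) →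
      x ∈ (f p).support → y ∈ (f p).support → x ≠ y → x ≠ T p → y ≠ T p →
      (∑ j, a j) + T p + T p ≠ (∑ j, T j) + x + y)
    (hparg : ∀ (a : Fin m → (Fin 2 →₀ ℕ)) (p : Fin m) (x y : Fin 2 →₀ ℕ), (∀ j, a j ∈ (g j).support) →
      x ∈ (g p).support → y ∈ (g p).support → x ≠ y → x ≠ T' p → y ≠ T' p →
      (∑ j, a j) + T' p + T' p ≠ (∑ j, T' j) + x + y)
    (e : Fin 2 →₀ ℕ)
    (hzero : ∀ x : Fin 2 →₀ ℕ, x ≠ e → l (emb e) ≤ l (emb x) → coeff x (∏ j, f j) + coeff x (∏ j, g j) = 0)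
    (htop : ∑ j, T j = ∑ j, T' j) (hTe : lexKey l e < lexKey l (∑ j, T j))
    {a : Fin m → (Fin 2 →₀ ℕ)} (ha : ∀ j, a j ∈ (f j).support) (hea : ∑ j, a j = e)
    (he : coeff e (∏ j, f j) + coeff e (∏ j, g j) ≠ 0) :
    (Finset.univ.filter fun i => a i ≠ T i).card ≤ 1 ∨
      ∃ (p : Fin m) (y₁ y₂ : Fin 2 →₀ ℕ), y₁ ∈ (g p).support ∧ y₂ ∈ (g p).support ∧ y₁ ≠ y₂ ∧ y₁ ≠ T' p ∧ y₂ ≠ T' p ∧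
        emb e = emb (∑ j, T' j) - (emb (T' p) - emb y₁) - (emb (T' p) - emb y₂) := by
  by_cases hcard : (Finset.univ.filter fun i => a i ≠ T i).card ≤ 1
  · exact Or.inl hcard
  right
  push Not at hcard
  set D := Finset.univ.filter fun i => a i ≠ T i with hD
  obtain ⟨j₁, hj₁, j₂, hj₂, hne12⟩ := Finset.one_lt_card.1 hcard
  -- every demoted coordinate gives a small single demotion, hence matched
  have hsingle : ∀ j₀ ∈ D, lexKey l e < lexKey l (∑ k, Function.update T j₀ (a j₀) k) := by
    intro j₀ hj₀
    rw [← hea]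
    refine lexKey_sum_lt_promote l f T hTmax ha (fun k => ?_) ?_
    · rcases eq_or_ne k j₀ with rfl | hk
      · left; rw [Function.update_self]
      · right; rw [Function.update_of_ne hk]
    · by_cases h : j₀ = j₁
      · subst h; exact ⟨j₂, by rw [Function.update_of_ne hne12.symm], ne_T_of_mem_filter T hj₂⟩
      · exact ⟨j₁, by rw [Function.update_of_ne (Ne.symm h)], ne_T_of_mem_filter T hj₁⟩
  have hM : ∀ j₀ ∈ D, ∃ (i : Fin m) (y : Fin 2 →₀ ℕ), (y ∈ (g i).support ∧ y ≠ T' i ∧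
      emb (T j₀) - emb (a j₀) = emb (T' i) - emb y) ∧ coeff (a j₀) (f j₀) / coeff (T j₀) (f j₀) = coeff y (g i) / coeff (T' i) (g i) := by
    intro j₀ hj₀
    obtain ⟨j, xl, i, y, hxl, hxlT, hy, hyT, h1, h2, hρ⟩ := matched_three l f g T T' hT hTmax hT' hTmax' hinjf hinjg hparf
      hparg e hzero htop hTe _ (hsingle j₀ hj₀) (Or.inl ⟨j₀, a j₀, ha j₀, ne_T_of_mem_filter T hj₀, rfl⟩)
    obtain ⟨hjj, hxx⟩ := update_sum_inj f T hT hinjf (ha j₀) (ne_T_of_mem_filter T hj₀) hxl h1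
    subst hjj; subst hxx
    refine ⟨i, y, ⟨hy, hyT, ?_⟩, hρ⟩
    have e1 := emb_sum_update T j₀ (a j₀)
    have e2 := emb_sum_update T' i y
    rw [h2, e2, ← htop] at e1
    exact (sub_right_inj.1 e1).symm
  haveI : Nonempty (Fin m) := ⟨j₁⟩
  choose! ii yy hyy hρ using hM
  by_cases hinjD : Set.InjOn ii D
  · -- injective matching: `e` is a word of `g` with the cancelling coefficient — contradiction
    exfalso
    obtain ⟨b, hbmem, -, hbsum, hbcoeff⟩ := transfer_letters g T T' hT' a D ii yy hyy hinjD
    have hbe : ∑ k, b k = e := by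
      apply emb_injective
      rw [hbsum, ← sum_gap_eq_sum_filter T a, ← htop, ← emb_sum_eq T a, hea]
    have hcf : coeff e (∏ j, f j) = (∏ j, coeff (T j) (f j)) * ∏ j ∈ D, (coeff (a j) (f j) / coeff (T j) (f j)) := by
      rw [← hea, coeff_word f hinjf _ ha, prod_coeff_ratio f T hT a]
    have hcg : coeff e (∏ j, g j) = (∏ j, coeff (T' j) (g j)) * ∏ j ∈ D, (coeff (a j) (f j) / coeff (T j) (f j)) := by
      rw [← hbe, coeff_word g hinjg _ hbmem, hbcoeff]
      congr 1
      exact Finset.prod_congr rfl fun j hj => (hρ j hj).symm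
    have hne : (∑ j, T j) ≠ e := fun h => by rw [h] at hTe; exact lt_irrefl _ hTe
    have hTc := hzero _ hne (apply_le_of_lexKey_le l hTe.le)
    rw [coeff_word f hinjf _ hT] at hTc
    rw [htop, coeff_word g hinjg _ hT'] at hTc
    apply he
    rw [hcf, hcg, ← add_mul, hTc, zero_mul]
  · -- two demoted coordinates matched into ONE coordinate `p` of `g`
    rw [Set.InjOn] at hinjD
    push Not at hinjD
    obtain ⟨j₃, hj₃, j₄, hj₄, hii, hj₃₄⟩ := hinjD
    have hyne : yy j₃ ≠ yy j₄ := by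
      intro hyeq
      have e3 := (hyy j₃ hj₃).2.2
      have e4 := (hyy j₄ hj₄).2.2
      rw [hii, hyeq, ← e4] at e3
      have hs : ∑ k, Function.update T j₃ (a j₃) k = ∑ k, Function.update T j₄ (a j₄) k := by
        apply emb_injective; rw [emb_sum_update, emb_sum_update, e3]
      exact hj₃₄ (update_sum_inj f T hT hinjf (ha j₃) (ne_T_of_mem_filter T hj₃) (ha j₄) hs).1
    have hzero' : ∀ x : Fin 2 →₀ ℕ, x ≠ e → l (emb e) ≤ l (emb x) →
        coeff x (∏ j, g j) + coeff x (∏ j, f j) = 0 := fun x hx hle => by rw [add_comm]; exact hzero x hx hle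
    rcases (Finset.univ.filter fun k => a k ≠ T k ∧ k ≠ j₃ ∧ k ≠ j₄).eq_empty_or_nonempty with h0 | ⟨j₅, hj₅⟩
    · -- exactly two demoted letters: the trinomial vertex shape
      refine ⟨ii j₃, yy j₃, yy j₄, (hyy j₃ hj₃).1, hii ▸ (hyy j₄ hj₄).1, hyne, (hyy j₃ hj₃).2.1,
        hii ▸ (hyy j₄ hj₄).2.1, ?_⟩
      have haeq : a = Function.update (Function.update T j₃ (a j₃)) j₄ (a j₄) := by
        funext k
        rcases eq_or_ne k j₄ with rfl | hk4
        · rw [Function.update_self]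
        · rw [Function.update_of_ne hk4]
          rcases eq_or_ne k j₃ with rfl | hk3
          · rw [Function.update_self]
          · rw [Function.update_of_ne hk3]
            by_contra hk
            have : k ∈ (Finset.univ.filter fun k => a k ≠ T k ∧ k ≠ j₃ ∧ k ≠ j₄) :=
              Finset.mem_filter.2 ⟨Finset.mem_univ _, hk, hk3, hk4⟩
            rw [h0] at this; exact absurd this (Finset.notMem_empty k)
      rw [← hea]
      conv_lhs => rw [haeq]
      rw [emb_sum_update_update T hj₃₄, (hyy j₃ hj₃).2.2, (hyy j₄ hj₄).2.2, hii, htop]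
    · -- a third demoted letter: the two-letter demotion is cancelled — a double match, impossible
      exfalso
      obtain ⟨-, hj₅a, hj₅3, hj₅4⟩ := Finset.mem_filter.1 hj₅
      refine no_double_match l g f T' T hT hinjg hinjf hparg e hzero' htop.symm hj₃₄ (ha j₃) (ha j₄)
        (hyy j₃ hj₃).1 (hii ▸ (hyy j₄ hj₄).1) hyne (hyy j₃ hj₃).2.1 (hii ▸ (hyy j₄ hj₄).2.1)
        (hyy j₃ hj₃).2.2 (hii ▸ (hyy j₄ hj₄).2.2) ?_
      rw [← hea]
      refine lexKey_sum_lt_promote l f T hTmax ha (fun k => ?_) ⟨j₅, ?_, hj₅a⟩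
      · rcases eq_or_ne k j₄ with rfl | hk4
        · left; rw [Function.update_self]
        · rw [Function.update_of_ne hk4]
          rcases eq_or_ne k j₃ with rfl | hk3
          · left; rw [Function.update_self]
          · right; rw [Function.update_of_ne hk3]
      · rw [Function.update_of_ne hj₅4, Function.update_of_ne hj₅3]

/-! ## Counting -/

/-- The trinomial-shape points `Σ b − (b_p − y₁) − (b_p − y₂)` over key-top tuples `b`, coordinates `p` and letter pairs lie in
a finite set of size `≤ (4 (m t)² + 7) · (m t²)`. -/
theorem card_cover2_le (t : ℕ) (g : Fin m → MvPolynomial (Fin 2) ℂ) (hS : ∀ j, ((g j).support).card ≤ t) :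
    (((Fintype.piFinset fun j => (g j).support).filter fun b =>
        ∃ l : (Fin 2 → ℝ) →L[ℝ] ℝ, ∀ j, ∀ x ∈ (g j).support, lexKey l x ≤ lexKey l (b j)).biUnion fun b =>
      Finset.univ.biUnion fun p => (((g p).support) ×ˢ ((g p).support)).image fun yy =>
        emb (∑ j, b j) - (emb (b p) - emb yy.1) - (emb (b p) - emb yy.2)).card
      ≤ (4 * (m * t) ^ 2 + 7) * (m * (t * t)) := by
  have hBT : ((Fintype.piFinset fun j => (g j).support).filter fun b =>
      ∃ l : (Fin 2 → ℝ) →L[ℝ] ℝ, ∀ j, ∀ x ∈ (g j).support, lexKey l x ≤ lexKey l (b j)).card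
      ≤ 4 * (m * t) ^ 2 + 7 :=
    stub_topTupleCount m t (fun j => (g j).support) hS
  calc _ ≤ ∑ b ∈ ((Fintype.piFinset fun j => (g j).support).filter fun b =>
          ∃ l : (Fin 2 → ℝ) →L[ℝ] ℝ, ∀ j, ∀ x ∈ (g j).support, lexKey l x ≤ lexKey l (b j)),
          (Finset.univ.biUnion fun p => (((g p).support) ×ˢ ((g p).support)).image fun yy =>
            emb (∑ j, b j) - (emb (b p) - emb yy.1) - (emb (b p) - emb yy.2)).card := Finset.card_biUnion_le
    _ ≤ ∑ _b ∈ ((Fintype.piFinset fun j => (g j).support).filter fun b =>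
          ∃ l : (Fin 2 → ℝ) →L[ℝ] ℝ, ∀ j, ∀ x ∈ (g j).support, lexKey l x ≤ lexKey l (b j)), m * (t * t) := by
        refine Finset.sum_le_sum fun b _ => ?_
        calc _ ≤ ∑ p, ((((g p).support) ×ˢ ((g p).support)).image fun yy =>
                emb (∑ j, b j) - (emb (b p) - emb yy.1) - (emb (b p) - emb yy.2)).card := Finset.card_biUnion_le
          _ ≤ ∑ _p : Fin m, t * t := Finset.sum_le_sum fun p _ => Finset.card_image_le.trans (by
              rw [Finset.card_product]; exact Nat.mul_le_mul (hS p) (hS p))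
          _ = m * (t * t) := by simp
    _ ≤ (4 * (m * t) ^ 2 + 7) * (m * (t * t)) := by
        rw [Finset.sum_const, smul_eq_mul]; exact Nat.mul_le_mul_right _ hBT

/-- The final arithmetic (`t ≤ 3`). -/
theorem count_arith_three (m t : ℕ) (ht : t ≤ 3) :
    2 * ((m * t + 1) * (4 * (m * t) ^ 2 + 7)) + 2 * ((4 * (m * t) ^ 2 + 7) * (m * (t * t))) ≤ (m * t + 2) ^ 6 := by
  set X := m * t with hX
  have h1 : m * (t * t) ≤ 3 * X := by
    rw [hX, ← mul_assoc, mul_comm 3]; exact Nat.mul_le_mul_left _ ht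
  calc 2 * ((X + 1) * (4 * X ^ 2 + 7)) + 2 * ((4 * X ^ 2 + 7) * (m * (t * t)))
      ≤ 2 * ((X + 1) * (4 * X ^ 2 + 7)) + 2 * ((4 * X ^ 2 + 7) * (3 * X)) := by gcongr
    _ ≤ 2 * ((X + 1) * (4 * X ^ 2 + 7)) + 2 * ((4 * X ^ 2 + 7) * (3 * X)) +
        (X ^ 6 + 12 * X ^ 5 + 60 * X ^ 4 + 128 * X ^ 3 + 232 * X ^ 2 + 136 * X + 50) := Nat.le_add_right _ _
    _ = (X + 2) ^ 6 := by ring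

end Vertex

end

end Summit.ValiantsHypothesis.ValiantsHypothesis.Theorems.NewtonFramesTwoProducts.FrameRungTwoTrinomial
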